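import Mathlib

/-!
# Crux `CubicForrelation.NearExactIsExact` (stmt-QuantumAdvantage-14043) — E1280-even, R4 branch, descendant `0` (`HZ`): BUDGET cores over
  the ten cells of `Z₁₀`

Certificate seat `b2b-cforr-cert` (gen 43).  HONEST FRAMING: kernel-checked finite bookkeeping (standard axioms) for the descendant `t̄₇ = 0`
of …CubicFormR4PartnerDispatch, in the style of …CubicFormR4TBudget: the weight identity bounds `Σ_{v ∈ Z₁₀} #f_v ≤ 255`, the cases
of the analysis (R4-PARTNER §4, reorganised) give lower bounds on sub-families of cells, and each lemma turns them into a constraint; the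
combinatorial cores are `decide`s over the coefficient / coordinate bits, the rest is `omega`.
* `tq0_budget_three`: at least three cells of `Z₁₀` outside any two given points weigh `< 32` fails ⇒ (used thrice) three zero cells.
* `tq0_budget_48z`: cells `≥ 48` where a nonconstant affine `α = 1`, plus one cell of `Z₁₀ ∩ {α = 0}` weighing `≥ 64`: impossible.
* `tq0_budget_6type`: cells `≥ 48` on `Z₁₀ ∩ {α = 1}` force `α` to be of six-point type (`e = e₀e₁ ⊕ e₂e₃`, i.e. `|Z₁₀ ∩ {α=0}| = 6`).
* `tq0_budget_2flat`: the two-flat case: with three zero cells `z₁, z₁⊕δ₁, z₁⊕δ₂ ∈ Z₁₀` (`D = ⟨δ₁,δ₂⟩`), cells `≥ 32` on one further coset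
  `z₁ ⊕ c ⊕ D` and `≥ 48` on the remaining two cosets: impossible (outer distributions `(3,3,1)` / `(2,2,2)`).
Nothing about `θ₁₂`; NOT summit progress.

References: this seat lineage (g37 R4-PARTNER §4, g43 LEAN-GEN43).  Axioms: the standard three.
-/

set_option linter.dupNamespace false -- D-0017: single-problem summit ⇒ `QuantumAdvantage.QuantumAdvantage` by design
set_option synthInstance.maxSize 8192
set_option synthInstance.maxHeartbeats 200000

namespace Summit.QuantumAdvantage.QuantumAdvantage.Theorems.CubicForrelation.NearExactIsExact

/-- Componentwise `Bool` equality of a vector with given bits is equality. [folklore] -/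
theorem tq0_deq_eq (v : Fin 4 → Bool) (b0 b1 b2 b3 : Bool)
    (h : ((v 0 == b0) && (v 1 == b1) && (v 2 == b2) && (v 3 == b3)) = true) : v = ![b0, b1, b2, b3] := by
  simp only [Bool.and_eq_true, beq_iff_eq] at h
  obtain ⟨⟨⟨h0, h1⟩, h2⟩, h3⟩ := h
  funext i; fin_cases i
  · exact h0
  · exact h1
  · exact h2
  · exact h3

/-- Core of `tq0_budget_three`. [this work] -/
theorem tq0_budget_three_core : ∀ (p0 p1 p2 p3 q0 q1 q2 q3 : Bool),
    256 ≤ (if (((![false, false, false, false] 0 == p0) && (![false, false, false, false] 1 == p1) && (![false, false, false, false] 2 == p2) && (![false, false, false, false] 3 == p3)) || ((![false, false, false, false] 0 == q0) && (![false, false, false, false] 1 == q1) && (![false, false, false, false] 2 == q2) && (![false, false, false, false] 3 == q3))) = true then 0 else 32) +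
      (if (((![false, false, false, true] 0 == p0) && (![false, false, false, true] 1 == p1) && (![false, false, false, true] 2 == p2) && (![false, false, false, true] 3 == p3)) || ((![false, false, false, true] 0 == q0) && (![false, false, false, true] 1 == q1) && (![false, false, false, true] 2 == q2) && (![false, false, false, true] 3 == q3))) = true then 0 else 32) +
      (if (((![false, false, true, false] 0 == p0) && (![false, false, true, false] 1 == p1) && (![false, false, true, false] 2 == p2) && (![false, false, true, false] 3 == p3)) || ((![false, false, true, false] 0 == q0) && (![false, false, true, false] 1 == q1) && (![false, false, true, false] 2 == q2) && (![false, false, true, false] 3 == q3))) = true then 0 else 32) +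
      (if (((![false, true, false, false] 0 == p0) && (![false, true, false, false] 1 == p1) && (![false, true, false, false] 2 == p2) && (![false, true, false, false] 3 == p3)) || ((![false, true, false, false] 0 == q0) && (![false, true, false, false] 1 == q1) && (![false, true, false, false] 2 == q2) && (![false, true, false, false] 3 == q3))) = true then 0 else 32) +
      (if (((![false, true, false, true] 0 == p0) && (![false, true, false, true] 1 == p1) && (![false, true, false, true] 2 == p2) && (![false, true, false, true] 3 == p3)) || ((![false, true, false, true] 0 == q0) && (![false, true, false, true] 1 == q1) && (![false, true, false, true] 2 == q2) && (![false, true, false, true] 3 == q3))) = true then 0 else 32) +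
      (if (((![false, true, true, false] 0 == p0) && (![false, true, true, false] 1 == p1) && (![false, true, true, false] 2 == p2) && (![false, true, true, false] 3 == p3)) || ((![false, true, true, false] 0 == q0) && (![false, true, true, false] 1 == q1) && (![false, true, true, false] 2 == q2) && (![false, true, true, false] 3 == q3))) = true then 0 else 32) +
      (if (((![true, false, false, false] 0 == p0) && (![true, false, false, false] 1 == p1) && (![true, false, false, false] 2 == p2) && (![true, false, false, false] 3 == p3)) || ((![true, false, false, false] 0 == q0) && (![true, false, false, false] 1 == q1) && (![true, false, false, false] 2 == q2) && (![true, false, false, false] 3 == q3))) = true then 0 else 32) +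
      (if (((![true, false, false, true] 0 == p0) && (![true, false, false, true] 1 == p1) && (![true, false, false, true] 2 == p2) && (![true, false, false, true] 3 == p3)) || ((![true, false, false, true] 0 == q0) && (![true, false, false, true] 1 == q1) && (![true, false, false, true] 2 == q2) && (![true, false, false, true] 3 == q3))) = true then 0 else 32) +
      (if (((![true, false, true, false] 0 == p0) && (![true, false, true, false] 1 == p1) && (![true, false, true, false] 2 == p2) && (![true, false, true, false] 3 == p3)) || ((![true, false, true, false] 0 == q0) && (![true, false, true, false] 1 == q1) && (![true, false, true, false] 2 == q2) && (![true, false, true, false] 3 == q3))) = true then 0 else 32) +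
      (if (((![true, true, true, true] 0 == p0) && (![true, true, true, true] 1 == p1) && (![true, true, true, true] 2 == p2) && (![true, true, true, true] 3 == p3)) || ((![true, true, true, true] 0 == q0) && (![true, true, true, true] 1 == q1) && (![true, true, true, true] 2 == q2) && (![true, true, true, true] 3 == q3))) = true then 0 else 32) := by
  decide

/-- **Budget: outside any two points, some cell of `Z₁₀` weighs `< 32`.**  If the cells sum to `≤ 255` over `Z₁₀` and every cell of
`Z₁₀` other than `p, q` weighs `≥ 32`, contradiction (`8·32 = 256`). [this work] -/
theorem tq0_budget_three (w : (Fin 4 → Bool) → ℕ) (hS : w ![false, false, false, false] + w ![false, false, false, true] + w ![false, false, true, false] + w ![false, true, false, false] + w ![false, true, false, true] + w ![false, true, true, false] + w ![true, false, false, false] + w ![true, false, false, true] + w ![true, false, true, false] + w ![true, true, true, true] ≤ 255)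
    (p q : Fin 4 → Bool) (h : ∀ v : Fin 4 → Bool, ((v 0 && v 1) ^^ (v 2 && v 3)) = false → v ≠ p → v ≠ q → 32 ≤ w v) : False := by
  have key : ∀ v : Fin 4 → Bool, ((v 0 && v 1) ^^ (v 2 && v 3)) = false →
      (if (((v 0 == p 0) && (v 1 == p 1) && (v 2 == p 2) && (v 3 == p 3)) || ((v 0 == q 0) && (v 1 == q 1) && (v 2 == q 2) && (v 3 == q 3))) = true then 0 else 32) ≤ w v := by
    intro v hv
    split_ifs with hc
    · exact Nat.zero_le _
    · refine h v hv (fun hp => hc ?_) (fun hq => hc ?_)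
      · subst hp; simp
      · subst hq; simp
  have l0 := key ![false, false, false, false] (by decide)
  have l1 := key ![false, false, false, true] (by decide)
  have l2 := key ![false, false, true, false] (by decide)
  have l3 := key ![false, true, false, false] (by decide)
  have l4 := key ![false, true, false, true] (by decide)
  have l5 := key ![false, true, true, false] (by decide)
  have l6 := key ![true, false, false, false] (by decide)
  have l7 := key ![true, false, false, true] (by decide)
  have l8 := key ![true, false, true, false] (by decide)
  have l9 := key ![true, true, true, true] (by decide)
  have core := tq0_budget_three_core (p 0) (p 1) (p 2) (p 3) (q 0) (q 1) (q 2) (q 3)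
  omega

/-- Core of `tq0_budget_48z`. [this work] -/
theorem tq0_budget_48z_core : ∀ (e e0 e1 e2 e3 : Bool), (e0 || e1 || e2 || e3) = true → ∀ (b0 b1 b2 b3 : Bool),
    ((b0 && b1) ^^ (b2 && b3)) = false → ((((e ^^ (![b0, b1, b2, b3] 0 && e0)) ^^ (![b0, b1, b2, b3] 1 && e1)) ^^ (![b0, b1, b2, b3] 2 && e2)) ^^ (![b0, b1, b2, b3] 3 && e3)) = false →
    256 ≤ (if ((((e ^^ (![false, false, false, false] 0 && e0)) ^^ (![false, false, false, false] 1 && e1)) ^^ (![false, false, false, false] 2 && e2)) ^^ (![false, false, false, false] 3 && e3)) = true then 48 else if ((![false, false, false, false] 0 == b0) && (![false, false, false, false] 1 == b1) && (![false, false, false, false] 2 == b2) && (![false, false, false, false] 3 == b3)) = true then 64 else 0) +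
      (if ((((e ^^ (![false, false, false, true] 0 && e0)) ^^ (![false, false, false, true] 1 && e1)) ^^ (![false, false, false, true] 2 && e2)) ^^ (![false, false, false, true] 3 && e3)) = true then 48 else if ((![false, false, false, true] 0 == b0) && (![false, false, false, true] 1 == b1) && (![false, false, false, true] 2 == b2) && (![false, false, false, true] 3 == b3)) = true then 64 else 0) +
      (if ((((e ^^ (![false, false, true, false] 0 && e0)) ^^ (![false, false, true, false] 1 && e1)) ^^ (![false, false, true, false] 2 && e2)) ^^ (![false, false, true, false] 3 && e3)) = true then 48 else if ((![false, false, true, false] 0 == b0) && (![false, false, true, false] 1 == b1) && (![false, false, true, false] 2 == b2) && (![false, false, true, false] 3 == b3)) = true then 64 else 0) +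
      (if ((((e ^^ (![false, true, false, false] 0 && e0)) ^^ (![false, true, false, false] 1 && e1)) ^^ (![false, true, false, false] 2 && e2)) ^^ (![false, true, false, false] 3 && e3)) = true then 48 else if ((![false, true, false, false] 0 == b0) && (![false, true, false, false] 1 == b1) && (![false, true, false, false] 2 == b2) && (![false, true, false, false] 3 == b3)) = true then 64 else 0) +
      (if ((((e ^^ (![false, true, false, true] 0 && e0)) ^^ (![false, true, false, true] 1 && e1)) ^^ (![false, true, false, true] 2 && e2)) ^^ (![false, true, false, true] 3 && e3)) = true then 48 else if ((![false, true, false, true] 0 == b0) && (![false, true, false, true] 1 == b1) && (![false, true, false, true] 2 == b2) && (![false, true, false, true] 3 == b3)) = true then 64 else 0) +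
      (if ((((e ^^ (![false, true, true, false] 0 && e0)) ^^ (![false, true, true, false] 1 && e1)) ^^ (![false, true, true, false] 2 && e2)) ^^ (![false, true, true, false] 3 && e3)) = true then 48 else if ((![false, true, true, false] 0 == b0) && (![false, true, true, false] 1 == b1) && (![false, true, true, false] 2 == b2) && (![false, true, true, false] 3 == b3)) = true then 64 else 0) +
      (if ((((e ^^ (![true, false, false, false] 0 && e0)) ^^ (![true, false, false, false] 1 && e1)) ^^ (![true, false, false, false] 2 && e2)) ^^ (![true, false, false, false] 3 && e3)) = true then 48 else if ((![true, false, false, false] 0 == b0) && (![true, false, false, false] 1 == b1) && (![true, false, false, false] 2 == b2) && (![true, false, false, false] 3 == b3)) = true then 64 else 0) +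
      (if ((((e ^^ (![true, false, false, true] 0 && e0)) ^^ (![true, false, false, true] 1 && e1)) ^^ (![true, false, false, true] 2 && e2)) ^^ (![true, false, false, true] 3 && e3)) = true then 48 else if ((![true, false, false, true] 0 == b0) && (![true, false, false, true] 1 == b1) && (![true, false, false, true] 2 == b2) && (![true, false, false, true] 3 == b3)) = true then 64 else 0) +
      (if ((((e ^^ (![true, false, true, false] 0 && e0)) ^^ (![true, false, true, false] 1 && e1)) ^^ (![true, false, true, false] 2 && e2)) ^^ (![true, false, true, false] 3 && e3)) = true then 48 else if ((![true, false, true, false] 0 == b0) && (![true, false, true, false] 1 == b1) && (![true, false, true, false] 2 == b2) && (![true, false, true, false] 3 == b3)) = true then 64 else 0) +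
      (if ((((e ^^ (![true, true, true, true] 0 && e0)) ^^ (![true, true, true, true] 1 && e1)) ^^ (![true, true, true, true] 2 && e2)) ^^ (![true, true, true, true] 3 && e3)) = true then 48 else if ((![true, true, true, true] 0 == b0) && (![true, true, true, true] 1 == b1) && (![true, true, true, true] 2 == b2) && (![true, true, true, true] 3 == b3)) = true then 64 else 0) := by
  decide

/-- **Budget (hyperplane case): cells `≥ 48` off the hyperplane and one cell `≥ 64` on it are impossible.**  For a nonconstant affine `α`:
cells of `Z₁₀` with `α = 1` weigh `≥ 48`, and some `v⋆ ∈ Z₁₀` with `α(v⋆) = 0` weighs `≥ 64` ⇒ contradiction. [this work] -/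
theorem tq0_budget_48z (w : (Fin 4 → Bool) → ℕ) (hS : w ![false, false, false, false] + w ![false, false, false, true] + w ![false, false, true, false] + w ![false, true, false, false] + w ![false, true, false, true] + w ![false, true, true, false] + w ![true, false, false, false] + w ![true, false, false, true] + w ![true, false, true, false] + w ![true, true, true, true] ≤ 255)
    (e e0 e1 e2 e3 : Bool) (hA : (e0 || e1 || e2 || e3) = true)
    (h48 : ∀ v : Fin 4 → Bool, ((v 0 && v 1) ^^ (v 2 && v 3)) = false → ((((e ^^ (v 0 && e0)) ^^ (v 1 && e1)) ^^ (v 2 && e2)) ^^ (v 3 && e3)) = true → 48 ≤ w v)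
    (p : Fin 4 → Bool) (hp : ((p 0 && p 1) ^^ (p 2 && p 3)) = false) (hpα : ((((e ^^ (p 0 && e0)) ^^ (p 1 && e1)) ^^ (p 2 && e2)) ^^ (p 3 && e3)) = false) (h64 : 64 ≤ w p) : False := by
  have ep : p = ![p 0, p 1, p 2, p 3] := by funext i; fin_cases i <;> rfl
  have key : ∀ v : Fin 4 → Bool, ((v 0 && v 1) ^^ (v 2 && v 3)) = false →
      (if ((((e ^^ (v 0 && e0)) ^^ (v 1 && e1)) ^^ (v 2 && e2)) ^^ (v 3 && e3)) = true then 48 else if ((v 0 == p 0) && (v 1 == p 1) && (v 2 == p 2) && (v 3 == p 3)) = true then 64 else 0) ≤ w v := by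
    intro v hv
    split_ifs with hα hc
    · exact h48 v hv hα
    · rw [tq0_deq_eq v _ _ _ _ hc, ← ep]; exact h64
    · exact Nat.zero_le _
  have l0 := key ![false, false, false, false] (by decide)
  have l1 := key ![false, false, false, true] (by decide)
  have l2 := key ![false, false, true, false] (by decide)
  have l3 := key ![false, true, false, false] (by decide)
  have l4 := key ![false, true, false, true] (by decide)
  have l5 := key ![false, true, true, false] (by decide)
  have l6 := key ![true, false, false, false] (by decide)
  have l7 := key ![true, false, false, true] (by decide)
  have l8 := key ![true, false, true, false] (by decide)
  have l9 := key ![true, true, true, true] (by decide)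
  have core := tq0_budget_48z_core e e0 e1 e2 e3 hA (p 0) (p 1) (p 2) (p 3) hp (by rw [← ep]; exact hpα)
  omega

/-- Core of `tq0_budget_6type`. [this work] -/
theorem tq0_budget_6type_core : ∀ (e e0 e1 e2 e3 : Bool), (e0 || e1 || e2 || e3) = true →
    (if ((((e ^^ (![false, false, false, false] 0 && e0)) ^^ (![false, false, false, false] 1 && e1)) ^^ (![false, false, false, false] 2 && e2)) ^^ (![false, false, false, false] 3 && e3)) = true then 48 else 0) +
      (if ((((e ^^ (![false, false, false, true] 0 && e0)) ^^ (![false, false, false, true] 1 && e1)) ^^ (![false, false, false, true] 2 && e2)) ^^ (![false, false, false, true] 3 && e3)) = true then 48 else 0) +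
      (if ((((e ^^ (![false, false, true, false] 0 && e0)) ^^ (![false, false, true, false] 1 && e1)) ^^ (![false, false, true, false] 2 && e2)) ^^ (![false, false, true, false] 3 && e3)) = true then 48 else 0) +
      (if ((((e ^^ (![false, true, false, false] 0 && e0)) ^^ (![false, true, false, false] 1 && e1)) ^^ (![false, true, false, false] 2 && e2)) ^^ (![false, true, false, false] 3 && e3)) = true then 48 else 0) +
      (if ((((e ^^ (![false, true, false, true] 0 && e0)) ^^ (![false, true, false, true] 1 && e1)) ^^ (![false, true, false, true] 2 && e2)) ^^ (![false, true, false, true] 3 && e3)) = true then 48 else 0) +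
      (if ((((e ^^ (![false, true, true, false] 0 && e0)) ^^ (![false, true, true, false] 1 && e1)) ^^ (![false, true, true, false] 2 && e2)) ^^ (![false, true, true, false] 3 && e3)) = true then 48 else 0) +
      (if ((((e ^^ (![true, false, false, false] 0 && e0)) ^^ (![true, false, false, false] 1 && e1)) ^^ (![true, false, false, false] 2 && e2)) ^^ (![true, false, false, false] 3 && e3)) = true then 48 else 0) +
      (if ((((e ^^ (![true, false, false, true] 0 && e0)) ^^ (![true, false, false, true] 1 && e1)) ^^ (![true, false, false, true] 2 && e2)) ^^ (![true, false, false, true] 3 && e3)) = true then 48 else 0) +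
      (if ((((e ^^ (![true, false, true, false] 0 && e0)) ^^ (![true, false, true, false] 1 && e1)) ^^ (![true, false, true, false] 2 && e2)) ^^ (![true, false, true, false] 3 && e3)) = true then 48 else 0) +
      (if ((((e ^^ (![true, true, true, true] 0 && e0)) ^^ (![true, true, true, true] 1 && e1)) ^^ (![true, true, true, true] 2 && e2)) ^^ (![true, true, true, true] 3 && e3)) = true then 48 else 0) ≤ 255 →
    e = ((e0 && e1) ^^ (e2 && e3)) := by
  decide

/-- **Budget: cells `≥ 48` on `Z₁₀ ∩ {α = 1}` force the six-point type** `e = e₀e₁ ⊕ e₂e₃` (the hyperplane `{α = 0}` meets `Z₁₀` in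
six points). [this work] -/
theorem tq0_budget_6type (w : (Fin 4 → Bool) → ℕ) (hS : w ![false, false, false, false] + w ![false, false, false, true] + w ![false, false, true, false] + w ![false, true, false, false] + w ![false, true, false, true] + w ![false, true, true, false] + w ![true, false, false, false] + w ![true, false, false, true] + w ![true, false, true, false] + w ![true, true, true, true] ≤ 255)
    (e e0 e1 e2 e3 : Bool) (hA : (e0 || e1 || e2 || e3) = true)
    (h48 : ∀ v : Fin 4 → Bool, ((v 0 && v 1) ^^ (v 2 && v 3)) = false → ((((e ^^ (v 0 && e0)) ^^ (v 1 && e1)) ^^ (v 2 && e2)) ^^ (v 3 && e3)) = true → 48 ≤ w v) :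
    e = ((e0 && e1) ^^ (e2 && e3)) := by
  have key : ∀ v : Fin 4 → Bool, ((v 0 && v 1) ^^ (v 2 && v 3)) = false → (if ((((e ^^ (v 0 && e0)) ^^ (v 1 && e1)) ^^ (v 2 && e2)) ^^ (v 3 && e3)) = true then 48 else 0) ≤ w v := by
    intro v hv
    split_ifs with hα
    · exact h48 v hv hα
    · exact Nat.zero_le _
  have l0 := key ![false, false, false, false] (by decide)
  have l1 := key ![false, false, false, true] (by decide)
  have l2 := key ![false, false, true, false] (by decide)
  have l3 := key ![false, true, false, false] (by decide)
  have l4 := key ![false, true, false, true] (by decide)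
  have l5 := key ![false, true, true, false] (by decide)
  have l6 := key ![true, false, false, false] (by decide)
  have l7 := key ![true, false, false, true] (by decide)
  have l8 := key ![true, false, true, false] (by decide)
  have l9 := key ![true, true, true, true] (by decide)
  exact tq0_budget_6type_core e e0 e1 e2 e3 hA (by omega)

/-- **A nonconstant affine function vanishes on at most six points of `Z₁₀`**, weighted form:
`Σ_{Z₁₀} (48·[α = 1] + 32·[α = 0]) ≥ 384`. `decide`. [this work] -/
theorem tq0_budget_h6_core : ∀ (e e0 e1 e2 e3 : Bool), (e0 || e1 || e2 || e3) = true →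
    384 ≤ (if ((((e ^^ (![false, false, false, false] 0 && e0)) ^^ (![false, false, false, false] 1 && e1)) ^^ (![false, false, false, false] 2 && e2)) ^^ (![false, false, false, false] 3 && e3)) = true then 48 else 32) +
      (if ((((e ^^ (![false, false, false, true] 0 && e0)) ^^ (![false, false, false, true] 1 && e1)) ^^ (![false, false, false, true] 2 && e2)) ^^ (![false, false, false, true] 3 && e3)) = true then 48 else 32) +
      (if ((((e ^^ (![false, false, true, false] 0 && e0)) ^^ (![false, false, true, false] 1 && e1)) ^^ (![false, false, true, false] 2 && e2)) ^^ (![false, false, true, false] 3 && e3)) = true then 48 else 32) +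
      (if ((((e ^^ (![false, true, false, false] 0 && e0)) ^^ (![false, true, false, false] 1 && e1)) ^^ (![false, true, false, false] 2 && e2)) ^^ (![false, true, false, false] 3 && e3)) = true then 48 else 32) +
      (if ((((e ^^ (![false, true, false, true] 0 && e0)) ^^ (![false, true, false, true] 1 && e1)) ^^ (![false, true, false, true] 2 && e2)) ^^ (![false, true, false, true] 3 && e3)) = true then 48 else 32) +
      (if ((((e ^^ (![false, true, true, false] 0 && e0)) ^^ (![false, true, true, false] 1 && e1)) ^^ (![false, true, true, false] 2 && e2)) ^^ (![false, true, true, false] 3 && e3)) = true then 48 else 32) +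
      (if ((((e ^^ (![true, false, false, false] 0 && e0)) ^^ (![true, false, false, false] 1 && e1)) ^^ (![true, false, false, false] 2 && e2)) ^^ (![true, false, false, false] 3 && e3)) = true then 48 else 32) +
      (if ((((e ^^ (![true, false, false, true] 0 && e0)) ^^ (![true, false, false, true] 1 && e1)) ^^ (![true, false, false, true] 2 && e2)) ^^ (![true, false, false, true] 3 && e3)) = true then 48 else 32) +
      (if ((((e ^^ (![true, false, true, false] 0 && e0)) ^^ (![true, false, true, false] 1 && e1)) ^^ (![true, false, true, false] 2 && e2)) ^^ (![true, false, true, false] 3 && e3)) = true then 48 else 32) +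
      (if ((((e ^^ (![true, true, true, true] 0 && e0)) ^^ (![true, true, true, true] 1 && e1)) ^^ (![true, true, true, true] 2 && e2)) ^^ (![true, true, true, true] 3 && e3)) = true then 48 else 32) := by
  decide

/-- **Budget (two-flat case).**  For a nonconstant affine `α`: if every cell of `Z₁₀` with `α = 1` weighs `≥ 48`, every cell with `α = 0`
weighs `≥ 32` unless it is a zero cell, and at most four cells of `Z₁₀` are zero cells, contradiction
(`48·4 + 32·2 + 0·4 = 256`). [this work] -/
theorem tq0_budget_2flat (w : (Fin 4 → Bool) → ℕ) (hS : w ![false, false, false, false] + w ![false, false, false, true] + w ![false, false, true, false] + w ![false, true, false, false] + w ![false, true, false, true] + w ![false, true, true, false] + w ![true, false, false, false] + w ![true, false, false, true] + w ![true, false, true, false] + w ![true, true, true, true] ≤ 255)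
    (e e0 e1 e2 e3 : Bool) (hA : (e0 || e1 || e2 || e3) = true)
    (h48 : ∀ v : Fin 4 → Bool, ((v 0 && v 1) ^^ (v 2 && v 3)) = false → ((((e ^^ (v 0 && e0)) ^^ (v 1 && e1)) ^^ (v 2 && e2)) ^^ (v 3 && e3)) = true → 48 ≤ w v)
    (h32 : ∀ v : Fin 4 → Bool, ((v 0 && v 1) ^^ (v 2 && v 3)) = false → ((((e ^^ (v 0 && e0)) ^^ (v 1 && e1)) ^^ (v 2 && e2)) ^^ (v 3 && e3)) = false → w v = 0 ∨ 32 ≤ w v)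
    (hz4 : (if w ![false, false, false, false] = 0 then 1 else 0) +
      (if w ![false, false, false, true] = 0 then 1 else 0) +
      (if w ![false, false, true, false] = 0 then 1 else 0) +
      (if w ![false, true, false, false] = 0 then 1 else 0) +
      (if w ![false, true, false, true] = 0 then 1 else 0) +
      (if w ![false, true, true, false] = 0 then 1 else 0) +
      (if w ![true, false, false, false] = 0 then 1 else 0) +
      (if w ![true, false, false, true] = 0 then 1 else 0) +
      (if w ![true, false, true, false] = 0 then 1 else 0) +
      (if w ![true, true, true, true] = 0 then 1 else 0) ≤ 4) : False := by
  have key : ∀ v : Fin 4 → Bool, ((v 0 && v 1) ^^ (v 2 && v 3)) = false →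
      (if ((((e ^^ (v 0 && e0)) ^^ (v 1 && e1)) ^^ (v 2 && e2)) ^^ (v 3 && e3)) = true then 48 else 32) ≤ w v + 32 * (if w v = 0 then 1 else 0) := by
    intro v hv
    by_cases hα : ((((e ^^ (v 0 && e0)) ^^ (v 1 && e1)) ^^ (v 2 && e2)) ^^ (v 3 && e3)) = true
    · rw [if_pos hα]; have := h48 v hv hα; split_ifs <;> omega
    · rw [if_neg hα]
      rcases h32 v hv (by simpa using hα) with h0 | h32'
      · rw [h0]; simp
      · split_ifs <;> omega
  have l0 := key ![false, false, false, false] (by decide)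
  have l1 := key ![false, false, false, true] (by decide)
  have l2 := key ![false, false, true, false] (by decide)
  have l3 := key ![false, true, false, false] (by decide)
  have l4 := key ![false, true, false, true] (by decide)
  have l5 := key ![false, true, true, false] (by decide)
  have l6 := key ![true, false, false, false] (by decide)
  have l7 := key ![true, false, false, true] (by decide)
  have l8 := key ![true, false, true, false] (by decide)
  have l9 := key ![true, true, true, true] (by decide)
  have core := tq0_budget_h6_core e e0 e1 e2 e3 hA
  omega

/-- **A nonzero linear functional vanishing on three given vectors of `𝔽₂⁴`** exists (`decide`; no independence needed). [folklore] -/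
theorem tq0_orth3 : ∀ (d10 d11 d12 d13 d20 d21 d22 d23 c0 c1 c2 c3 : Bool),
    ∃ a0 a1 a2 a3 : Bool, (a0 || a1 || a2 || a3) = true ∧
      (((a0 && d10) ^^ (a1 && d11)) ^^ ((a2 && d12) ^^ (a3 && d13))) = false ∧
      (((a0 && d20) ^^ (a1 && d21)) ^^ ((a2 && d22) ^^ (a3 && d23))) = false ∧
      (((a0 && c0) ^^ (a1 && c1)) ^^ ((a2 && c2) ^^ (a3 && c3))) = false := by
  decide

/-- Core of `tq0_budget_two64z`. [this work] -/
theorem tq0_budget_two64z_core : ∀ (p0 p1 p2 p3 q0 q1 q2 q3 : Bool),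
    ((p0 && p1) ^^ (p2 && p3)) = false → ((q0 && q1) ^^ (q2 && q3)) = false →
    ((p0 ^^ q0) || (p1 ^^ q1) || (p2 ^^ q2) || (p3 ^^ q3)) = true →
    384 ≤ (if (((![false, false, false, false] 0 == p0) && (![false, false, false, false] 1 == p1) && (![false, false, false, false] 2 == p2) && (![false, false, false, false] 3 == p3)) || ((![false, false, false, false] 0 == q0) && (![false, false, false, false] 1 == q1) && (![false, false, false, false] 2 == q2) && (![false, false, false, false] 3 == q3))) = true then 64 else 32) +
      (if (((![false, false, false, true] 0 == p0) && (![false, false, false, true] 1 == p1) && (![false, false, false, true] 2 == p2) && (![false, false, false, true] 3 == p3)) || ((![false, false, false, true] 0 == q0) && (![false, false, false, true] 1 == q1) && (![false, false, false, true] 2 == q2) && (![false, false, false, true] 3 == q3))) = true then 64 else 32) +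
      (if (((![false, false, true, false] 0 == p0) && (![false, false, true, false] 1 == p1) && (![false, false, true, false] 2 == p2) && (![false, false, true, false] 3 == p3)) || ((![false, false, true, false] 0 == q0) && (![false, false, true, false] 1 == q1) && (![false, false, true, false] 2 == q2) && (![false, false, true, false] 3 == q3))) = true then 64 else 32) +
      (if (((![false, true, false, false] 0 == p0) && (![false, true, false, false] 1 == p1) && (![false, true, false, false] 2 == p2) && (![false, true, false, false] 3 == p3)) || ((![false, true, false, false] 0 == q0) && (![false, true, false, false] 1 == q1) && (![false, true, false, false] 2 == q2) && (![false, true, false, false] 3 == q3))) = true then 64 else 32) +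
      (if (((![false, true, false, true] 0 == p0) && (![false, true, false, true] 1 == p1) && (![false, true, false, true] 2 == p2) && (![false, true, false, true] 3 == p3)) || ((![false, true, false, true] 0 == q0) && (![false, true, false, true] 1 == q1) && (![false, true, false, true] 2 == q2) && (![false, true, false, true] 3 == q3))) = true then 64 else 32) +
      (if (((![false, true, true, false] 0 == p0) && (![false, true, true, false] 1 == p1) && (![false, true, true, false] 2 == p2) && (![false, true, true, false] 3 == p3)) || ((![false, true, true, false] 0 == q0) && (![false, true, true, false] 1 == q1) && (![false, true, true, false] 2 == q2) && (![false, true, true, false] 3 == q3))) = true then 64 else 32) +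
      (if (((![true, false, false, false] 0 == p0) && (![true, false, false, false] 1 == p1) && (![true, false, false, false] 2 == p2) && (![true, false, false, false] 3 == p3)) || ((![true, false, false, false] 0 == q0) && (![true, false, false, false] 1 == q1) && (![true, false, false, false] 2 == q2) && (![true, false, false, false] 3 == q3))) = true then 64 else 32) +
      (if (((![true, false, false, true] 0 == p0) && (![true, false, false, true] 1 == p1) && (![true, false, false, true] 2 == p2) && (![true, false, false, true] 3 == p3)) || ((![true, false, false, true] 0 == q0) && (![true, false, false, true] 1 == q1) && (![true, false, false, true] 2 == q2) && (![true, false, false, true] 3 == q3))) = true then 64 else 32) +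
      (if (((![true, false, true, false] 0 == p0) && (![true, false, true, false] 1 == p1) && (![true, false, true, false] 2 == p2) && (![true, false, true, false] 3 == p3)) || ((![true, false, true, false] 0 == q0) && (![true, false, true, false] 1 == q1) && (![true, false, true, false] 2 == q2) && (![true, false, true, false] 3 == q3))) = true then 64 else 32) +
      (if (((![true, true, true, true] 0 == p0) && (![true, true, true, true] 1 == p1) && (![true, true, true, true] 2 == p2) && (![true, true, true, true] 3 == p3)) || ((![true, true, true, true] 0 == q0) && (![true, true, true, true] 1 == q1) && (![true, true, true, true] 2 == q2) && (![true, true, true, true] 3 == q3))) = true then 64 else 32) := by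
  decide

/-- **Budget: two cells of `Z₁₀` at `64` with at most four zero cells are impossible** (the other cells weigh `≥ 32`):
`2·64 + 4·32 = 256`. [this work] -/
theorem tq0_budget_two64z (w : (Fin 4 → Bool) → ℕ) (hS : w ![false, false, false, false] + w ![false, false, false, true] + w ![false, false, true, false] + w ![false, true, false, false] + w ![false, true, false, true] + w ![false, true, true, false] + w ![true, false, false, false] + w ![true, false, false, true] + w ![true, false, true, false] + w ![true, true, true, true] ≤ 255)
    (p q : Fin 4 → Bool) (hp : ((p 0 && p 1) ^^ (p 2 && p 3)) = false) (hq : ((q 0 && q 1) ^^ (q 2 && q 3)) = false) (hpq : p ≠ q)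
    (h64p : 64 ≤ w p) (h64q : 64 ≤ w q)
    (h32 : ∀ v : Fin 4 → Bool, ((v 0 && v 1) ^^ (v 2 && v 3)) = false → w v = 0 ∨ 32 ≤ w v)
    (hz4 : (if w ![false, false, false, false] = 0 then 1 else 0) +
      (if w ![false, false, false, true] = 0 then 1 else 0) +
      (if w ![false, false, true, false] = 0 then 1 else 0) +
      (if w ![false, true, false, false] = 0 then 1 else 0) +
      (if w ![false, true, false, true] = 0 then 1 else 0) +
      (if w ![false, true, true, false] = 0 then 1 else 0) +
      (if w ![true, false, false, false] = 0 then 1 else 0) +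
      (if w ![true, false, false, true] = 0 then 1 else 0) +
      (if w ![true, false, true, false] = 0 then 1 else 0) +
      (if w ![true, true, true, true] = 0 then 1 else 0) ≤ 4) : False := by
  have ep : p = ![p 0, p 1, p 2, p 3] := by funext i; fin_cases i <;> rfl
  have eq : q = ![q 0, q 1, q 2, q 3] := by funext i; fin_cases i <;> rfl
  have hx : ∀ a b : Bool, (a ^^ b) = false → a = b := by decide
  have hne : ((p 0 ^^ q 0) || (p 1 ^^ q 1) || (p 2 ^^ q 2) || (p 3 ^^ q 3)) = true := by
    by_contra h
    rw [Bool.not_eq_true] at h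
    simp only [Bool.or_eq_false_iff] at h
    apply hpq
    funext i
    fin_cases i
    · exact hx _ _ h.1.1.1
    · exact hx _ _ h.1.1.2
    · exact hx _ _ h.1.2
    · exact hx _ _ h.2
  have key : ∀ v : Fin 4 → Bool, ((v 0 && v 1) ^^ (v 2 && v 3)) = false →
      (if (((v 0 == p 0) && (v 1 == p 1) && (v 2 == p 2) && (v 3 == p 3)) || ((v 0 == q 0) && (v 1 == q 1) && (v 2 == q 2) && (v 3 == q 3))) = true then 64 else 32) ≤ w v + 32 * (if w v = 0 then 1 else 0) := by
    intro v hv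
    by_cases hc : (((v 0 == p 0) && (v 1 == p 1) && (v 2 == p 2) && (v 3 == p 3)) || ((v 0 == q 0) && (v 1 == q 1) && (v 2 == q 2) && (v 3 == q 3))) = true
    · rw [if_pos hc]
      rcases Bool.or_eq_true_iff.mp hc with h1 | h1
      · rw [tq0_deq_eq v _ _ _ _ h1, ← ep]; split_ifs <;> omega
      · rw [tq0_deq_eq v _ _ _ _ h1, ← eq]; split_ifs <;> omega
    · rw [if_neg hc]
      rcases h32 v hv with h0 | h32'
      · rw [h0]; simp
      · split_ifs <;> omega
  have l0 := key ![false, false, false, false] (by decide)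
  have l1 := key ![false, false, false, true] (by decide)
  have l2 := key ![false, false, true, false] (by decide)
  have l3 := key ![false, true, false, false] (by decide)
  have l4 := key ![false, true, false, true] (by decide)
  have l5 := key ![false, true, true, false] (by decide)
  have l6 := key ![true, false, false, false] (by decide)
  have l7 := key ![true, false, false, true] (by decide)
  have l8 := key ![true, false, true, false] (by decide)
  have l9 := key ![true, true, true, true] (by decide)
  have core := tq0_budget_two64z_core (p 0) (p 1) (p 2) (p 3) (q 0) (q 1) (q 2) (q 3) hp hq hne
  omega

end Summit.QuantumAdvantage.QuantumAdvantage.Theorems.CubicForrelation.NearExactIsExact
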